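import Summits.MatrixMultiplication.MatrixMultiplication.Theses.WindowedCompletionRank
import Summits.MatrixMultiplication.MatrixMultiplication.Theses.DesignFlattening
import Literature.Computability.AlgebraicComplexity.TensorRankFactsProofs

/-!
# MatrixMultiplication / WindowedCompletionRank — `HadamardRankLe`

Support item `stmt-MatrixMultiplication-5496` (`HadamardRankLe`, wanted by the routes
`WindowedCompletionRank` and `DesignFlattening` with the same signature): Hadamard (entrywise)
products of 3-tensors over `ℂ` on finite index types are rank-submultiplicative,
`R(s ∘ t) ≤ R(s)·R(t)` (Bürgisser–Clausen–Shokrollahi 1997, Prop. 14.23 and its proof;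
Bläser 2013, Lemma 5.8: the product of two triad decompositions is a triad decomposition).

Proof: the entrywise product `(a, b, c) ↦ s a b c · t a b c` is the restriction of the Kronecker
(outer) product `kroneckerTensor s t : ((a,a'), (b,b'), (c,c')) ↦ s a b c · t a' b' c'` along the
three diagonal maps `a ↦ (a, a)`, so `R(s ∘ t) ≤ R(s ⊗ t) ≤ R(s)·R(t)` by
`Literature.Computability.AlgebraicComplexity.tensorRank_precomp_le` (Bläser 2013, Lemma 5.4,
restriction along index maps) and `Literature.Computability.AlgebraicComplexity.Blaser2013_lemma58`
(Kronecker submultiplicativity), both proved in the tree. The inequality is recorded over an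
arbitrary commutative semiring first (`tensorRank_hadamard_le`), then specialised to the two
(identical) route declarations.
-/

-- single-problem summit: `Summit.MatrixMultiplication.MatrixMultiplication.…` is the mandated namespace
set_option linter.dupNamespace false

noncomputable section

namespace Summit.MatrixMultiplication.MatrixMultiplication.Theorems

universe u v₁ v₂ v₃

/-- Hadamard (entrywise) products are rank-submultiplicative over any commutative semiring, for
tensors on finite index types: `R(s ∘ t) ≤ R(s)·R(t)` — the entrywise product is the diagonal
restriction of the Kronecker product `s ⊗ t`, whose rank is at most `R(s)·R(t)`.
[cite: Blaser2013, Lemma 5.8] -/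
theorem tensorRank_hadamard_le {K : Type u} [CommSemiring K] {ι : Type v₁} {κ : Type v₂}
    {μ : Type v₃} [Fintype ι] [Fintype κ] [Fintype μ] (s t : ι → κ → μ → K) :
    Literature.Computability.AlgebraicComplexity.tensorRank (fun a b c => s a b c * t a b c) ≤
      Literature.Computability.AlgebraicComplexity.tensorRank s *
        Literature.Computability.AlgebraicComplexity.tensorRank t :=
  (Literature.Computability.AlgebraicComplexity.tensorRank_precomp_le
      (Literature.Computability.AlgebraicComplexity.kroneckerTensor s t)
      (fun a : ι => (a, a)) (fun b : κ => (b, b)) (fun c : μ => (c, c))).trans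
    (Literature.Computability.AlgebraicComplexity.Blaser2013_lemma58 s t)

/-- Settles `stmt-MatrixMultiplication-5496` for route `WindowedCompletionRank`: the route
declaration `HadamardRankLe` (`R(s ∘ t) ≤ R(s)·R(t)` for 3-tensors over `ℂ` on finite index
types). [cite: Blaser2013, Lemma 5.8] -/
theorem hadamardRankLe_proof :
    Summit.MatrixMultiplication.MatrixMultiplication.Theses.WindowedCompletionRank.HadamardRankLe := by
  unfold Summit.MatrixMultiplication.MatrixMultiplication.Theses.WindowedCompletionRank.HadamardRankLe
  intro ι κ μ _ _ _ s t
  exact tensorRank_hadamard_le s t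

/-- The same statement as filed by route `DesignFlattening` (identical signature, same ledger item
`stmt-MatrixMultiplication-5496`). [cite: Blaser2013, Lemma 5.8] -/
theorem designFlattening_hadamardRankLe_proof :
    Summit.MatrixMultiplication.MatrixMultiplication.Theses.DesignFlattening.HadamardRankLe := by
  unfold Summit.MatrixMultiplication.MatrixMultiplication.Theses.DesignFlattening.HadamardRankLe
  intro ι κ μ _ _ _ s t
  exact tensorRank_hadamard_le s t

end Summit.MatrixMultiplication.MatrixMultiplication.Theorems
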